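import Literature.NumberTheory.QuadraticFields.BinaryQuadraticFormsClassNumberCountChunks
import HarnessLib

/-!
# Class number of `D = −114 148 483` by row chunks, file G2 of 5: rows `(2758, 3185] ↦ 42`, `(3185, 3561] ↦ 50`, `(3561, 3901] ↦ 36`

Topic `NumberTheory/QuadraticFields`, namespace `Literature.NumberTheory.QuadraticFields.Quadratic`; pure VALUES file (theorems only). The landau-siegel
rescue bed's deep negative ladder rung `D_83^− = −114 148 483` (= 101·463·2441; Lehmer–Lehmer–Shanks 1970) has
`h = 692` (engines A ≡ B of record). Its kernel evaluation by Cohen's Algorithm 5.3.5 (`BinQF.classNumberCount`,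
`BinaryQuadraticFormsClassNumberCount.lean`) needs ≈ 15 min of kernel time, beyond one declaration's budget (≈ 150 s) and one
file's (≈ 600 s), so the row range `1 ≤ a ≤ 6168` is cut into 15 chunks of roughly equal work (`BinQF.redRowsSumFrom`,
`BinaryQuadraticFormsClassNumberCountChunks.lean`), three per file; the assembly `BinQF.classNumber (−114148483) = 692` by
`BinQF.redRowsSumFrom_add` is in `ImaginaryQuadraticClassNumbersDeepI.lean`.

## References

* [Cohen1993] H. Cohen, *A Course in Computational Algebraic Number Theory*, GTM 138, §5.3.1 Algorithm 5.3.5.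
* [LehmerLehmerShanks1970] D. H. Lehmer, E. Lehmer, D. Shanks, Math. Comp. 24 (1970) 433–451, §1 and Table.
-/

namespace Literature.NumberTheory.QuadraticFields.Quadratic

/-- Row chunk `a ∈ (2758, 3185]` of Cohen's Algorithm 5.3.5 at `N = 114 148 483`: partial count `42` (one kernel evaluation).
[cite: Cohen1993, §5.3.1 Algorithm 5.3.5] -/
theorem redRowsSumFrom_114148483_2758 : BinQF.redRowsSumFrom 114148483 2758 427 = 42 := by
  decide +kernel

/-- Row chunk `a ∈ (3185, 3561]` of Cohen's Algorithm 5.3.5 at `N = 114 148 483`: partial count `50` (one kernel evaluation).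
[cite: Cohen1993, §5.3.1 Algorithm 5.3.5] -/
theorem redRowsSumFrom_114148483_3185 : BinQF.redRowsSumFrom 114148483 3185 376 = 50 := by
  decide +kernel

/-- Row chunk `a ∈ (3561, 3901]` of Cohen's Algorithm 5.3.5 at `N = 114 148 483`: partial count `36` (one kernel evaluation).
[cite: Cohen1993, §5.3.1 Algorithm 5.3.5] -/
theorem redRowsSumFrom_114148483_3561 : BinQF.redRowsSumFrom 114148483 3561 340 = 36 := by
  decide +kernel

end Literature.NumberTheory.QuadraticFields.Quadratic
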